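import Mathlib
import Literature.NumberTheory.LFunctions.Zhang2022.SkeletonChiTwist
import Literature.NumberTheory.LFunctions.Zhang2022.SkeletonPartOneC
import HarnessLib

/-!
# Zhang (2022), typed skeleton XV: the reading `α₁ := α·log T` of the manuscript's undefined `α₁`,
# and the nodes that carry it (Lemma 12.1, Lemma 15.1) re-banked

Topic `Literature/NumberTheory/LFunctions/Zhang2022` (Landau–Siegel audit tree; verdict-neutral).
Y. Zhang, *Discrete mean estimates and the Landau–Siegel zero*, arXiv:2211.02515v1 (2022)
[Zhang2022LandauSiegel] — **an unrefereed manuscript under adjudication; every `def … : Prop`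
below is a CLAIM OF THE MANUSCRIPT, STATED NOT ASSERTED** (a named hypothesis of the whole-DAG
theorem), as in `SkeletonPropositions` … `SkeletonChiTwist`.

Why this file exists (campaign D-0069, gap row G-L4t10-2 "the α₁-reading family", L4-t10's
analysis and the L4-lead recommendation of 2026-08-26T00:04Z): the symbol `α₁` is used 29 times
in the manuscript (tex L1972 … L5333) and defined nowhere. The banked skeleton reads `α₁ := α𝓛`
(`Lemma121`, `Lemma151`, hence `Lemma151Chi`). Two families of displays are FALSE under that
reading by exactly a factor `𝓛^{0.1}` and TRUE with `α₁ := α·log T = α𝓛^{1.1}` (`T = exp{𝓛^{1.1}}`,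
§6): Appendix B §B.u010 "`−β_j/(β₇² log P₂) = −8j/(25πi) + O(α₁)`" (exactly
`(8ji/25π)(1+κ_jc′α𝓛)/(1 − 20𝓛^{−7.9})`, off by `≍ 𝓛^{−7.9} ≫ α𝓛 = π𝓛⁻⁸`), and §12's
"`ϰ₁₃(n) ≪ α₁` for `P″₁/T ≤ n ≤ P″₁T`" (`|ϰ₁₃| ≤ log T/log P₁ ≍ α𝓛^{1.1}`, attained). Every
downstream use consumes only `α₁ = o(1)`. RULING (skeleton owner): **`α₁ := α·log T`**, the object
`alpha1 D := alpha D · log(bigT D)`; the nodes that carry `α₁` are re-banked with it —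
`Lemma121R c′` (Lemma 12.1, second clause `≪ α₁`) and `Lemma151ChiR c′` (Lemma 15.1 in the
χ-twisted reading of `SkeletonChiTwist`, error `O(α₁τ₂(n₁))`) — together with the proof nodes
that consume them (`Ded1217R`, `Ded1524ChiR`, `Ded1617ChiR`, `Ded1710ChiR`) and the comparison
edges from the banked `α𝓛`-forms (which are the STRONGER claims: `α𝓛 ≤ α log T` once `𝓛 ≥ 1`).
The whole-DAG re-threads from `v6` on use the `R` forms (`SkeletonWholeDAGv6`, theorems only).

What is NOT asserted: any of these claims. Nothing here bears on Theorems 1–2 of the source.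

## References

* Y. Zhang, arXiv:2211.02515v1 (2022), §6 p. 12 (`T`), §12 Lemma 12.1 (p. 25), §15 Lemma 15.1
  (p. 31), Appendix B (p. 107, tex L5301). [cite: Zhang2022LandauSiegel, §12 Lemma 12.1]
-/

noncomputable section

open Complex Real

namespace Literature.NumberTheory.LFunctions.Zhang2022.Skeleton

/-! ## The object `α₁` -/

/-- **`α₁ := α·log T`** (`= α𝓛^{1.1}`, `T = exp{𝓛^{1.1}}` of §6): the reading of record of the
manuscript's undefined `α₁` (29 uses; every use is an error term `O(α₁)` consumed as `o(1)`).
[cite: Zhang2022LandauSiegel, §6 p. 12] -/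
def alpha1 (D : ℕ) : ℝ := alpha D * Real.log (bigT D)

/-- `log T = 𝓛^{1.1}`. [cite: Zhang2022LandauSiegel, §6 p. 12] -/
theorem log_bigT (D : ℕ) : Real.log (bigT D) = ell D ^ (1.1 : ℝ) := by
  rw [bigT, Real.log_exp]

/-- `α𝓛 ≤ α₁` for `D ≥ 3` (`𝓛 ≥ 1`, `α > 0`): the banked `α𝓛`-readings are the stronger claims.
[cite: Zhang2022LandauSiegel, §6 p. 12] -/
theorem alpha_mul_ell_le_alpha1 {D : ℕ} (hD : 3 ≤ D) : alpha D * ell D ≤ alpha1 D := by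
  rw [alpha1, log_bigT]
  have h1 : 1 ≤ ell D := (one_lt_ell hD).le
  refine mul_le_mul_of_nonneg_left ?_ (alpha_pos hD).le
  calc ell D = ell D ^ (1 : ℝ) := (Real.rpow_one _).symm
    _ ≤ ell D ^ (1.1 : ℝ) := Real.rpow_le_rpow_of_exponent_le h1 (by norm_num)

variable (c' : ℝ)

/-! ## Lemma 12.1 and Lemma 15.1 with `α₁ = α log T` -/

/-- **Lemma 12.1, `α₁ := α log T` reading** (§12 p. 25; `1 ≤ j ≤ 3`): the banked `Lemma121 c′`
verbatim except that the second clause "`≪ α₁` if `P″₁/T < d ≤ P″₁`" is typed `≤ C·α₁` with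
`α₁ = alpha1 D`. CLAIM, stated not asserted. [cite: Zhang2022LandauSiegel, §12 Lemma 12.1] -/
def Lemma121R : Prop :=
  ∃ c : ℝ, 0 < c ∧ ∃ C : ℝ, ForAllLarge fun D _ χ => AssumptionA D χ →
    ∀ j ∈ ({1, 2, 3} : Finset ℕ), ∀ d : ℕ, 1 ≤ d →
      let S : ℂ := ∑ l ∈ Finset.Ico 1 ⌈P2pp D⌉₊,
        χ (l : ZMod D) * vk13 D (d * l) / (l : ℂ) ^ (1 - betaJ c' D j)
      ((d : ℝ) ≤ P1pp D / bigT D → ‖S‖ ≤ C * bigT D ^ (-c)) ∧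
      (P1pp D / bigT D < d → (d : ℝ) ≤ P1pp D → ‖S‖ ≤ C * alpha1 D) ∧
      (P1pp D < d → (d : ℝ) < P2 D →
        ‖S - deriv χ.LFunction 1 / Real.log (P1 D) *
            (-1 + (2 * beta6 D - betaJ c' D j) * (Real.log (d / P1pp D) : ℂ))‖ ≤
          1e-5 * ‖deriv χ.LFunction 1‖ / Real.log (P1 D))

/-- **Lemma 15.1, χ-twisted reading with `α₁ := α log T`** (§15 p. 31): the node `Lemma151Chi c′`
of `SkeletonChiTwist` verbatim except that the error `O(α₁τ₂(n₁))` is typed `C·α₁·τ₂(n₁)` with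
`α₁ = alpha1 D`. CLAIM, stated not asserted. [cite: Zhang2022LandauSiegel, §15 Lemma 15.1] -/
def Lemma151ChiR : Prop :=
  ∃ C : ℝ, ForAllLarge fun D _ χ => AssumptionA D χ → ∀ j ∈ ({1, 2, 3} : Finset ℕ), ∀ n₁ : ℕ,
    n₁ ∈ nset (frakq D) → (n₁ : ℝ) < bigT D →
      ‖(∑ n ∈ (Finset.Ico 1 ⌈bigP D⌉₊).filter (fun n => Nat.Coprime n (frakq D)),
          χ ((n₁ * n : ℕ) : ZMod D) * bcoef D (n₁ * n) * χ (n : ZMod D) *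
            varrhoStar c' χ j n / (n : ℂ)) -
        χ (n₁ : ZMod D) * (n₁.divisors.card : ℂ) * frake j‖ ≤
      C * alpha1 D * n₁.divisors.card

/-- **§12, (12.6)–(12.17) from Lemma 12.1 in the `α₁` reading**: the banked `Ded1217` with
`Lemma121R` as its Lemma-12.1 antecedent. CLAIM. [cite: Zhang2022LandauSiegel, §12 (12.6)–(12.17)] -/
def Ded1217R : Prop :=
  Prop71 c' → Lemma81 c' → Lemma82 c' → Lemma83 c' → Lemma84 c' → Lemma58 → Lemma121R c' →
    Lemma123 c' → Eval1217 c'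

/-- **§15 ⇒ (15.24) from `Lemma151ChiR`** (the banked `Ded1524`/`Ded1524Chi` with the `α₁`-reading
antecedent). CLAIM. [cite: Zhang2022LandauSiegel, §15 (15.1)–(15.24)] -/
def Ded1524ChiR : Prop := Prop141 → Lemma55 → Lemma58 → Lemma151ChiR c' → Eval1524 c'

/-- **§16 ⇒ (16.17) from `Lemma151ChiR`**. CLAIM. [cite: Zhang2022LandauSiegel, §16 (16.1)–(16.17)] -/
def Ded1617ChiR : Prop := Prop141 → Lemma55 → Lemma58 → Lemma151ChiR c' → Eval1617 c'

/-- **§17 ⇒ (17.10) from `Lemma151ChiR`**. CLAIM. [cite: Zhang2022LandauSiegel, §17 (17.1)–(17.10)] -/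
def Ded1710ChiR : Prop := Prop141 → AppBLemma171 → Lemma151ChiR c' → Eval1710 c'

/-! ## Comparison edges: the banked `α𝓛`-forms are the stronger claims -/

/-- `Lemma121 c′` (error `α𝓛`) implies `Lemma121R c′` (error `α log T`).
[cite: Zhang2022LandauSiegel, §12 Lemma 12.1] -/
theorem lemma121R_of_lemma121 {c' : ℝ} (h : Lemma121 c') : Lemma121R c' := by
  obtain ⟨c, hc, C, D₀, hD₀⟩ := h
  refine ⟨c, hc, |C|, max D₀ 3, fun D _ χ hD hq hp hA j hj d hd => ?_⟩
  have hD3 : 3 ≤ D := le_trans (le_max_right _ _) hD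
  obtain ⟨h1, h2, h3⟩ := hD₀ D χ (le_trans (le_max_left _ _) hD) hq hp hA j hj d hd
  have hαℓ : 0 ≤ alpha D * ell D := mul_nonneg (alpha_pos hD3).le (by linarith [one_lt_ell hD3])
  intro S
  refine ⟨fun hd1 => (h1 hd1).trans ?_, fun hd1 hd2 => (h2 hd1 hd2).trans ?_, h3⟩
  · exact mul_le_mul_of_nonneg_right (le_abs_self C) (Real.rpow_nonneg (by unfold bigT; positivity) _)
  · calc C * alpha D * ell D = C * (alpha D * ell D) := by ring
      _ ≤ |C| * (alpha D * ell D) := mul_le_mul_of_nonneg_right (le_abs_self C) hαℓ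
      _ ≤ |C| * alpha1 D := mul_le_mul_of_nonneg_left (alpha_mul_ell_le_alpha1 hD3) (abs_nonneg C)

/-- `Lemma151Chi c′` (error `α𝓛τ₂`) implies `Lemma151ChiR c′` (error `α₁τ₂`).
[cite: Zhang2022LandauSiegel, §15 Lemma 15.1] -/
theorem lemma151ChiR_of_lemma151Chi {c' : ℝ} (h : Lemma151Chi c') : Lemma151ChiR c' := by
  obtain ⟨C, D₀, hD₀⟩ := h
  refine ⟨|C|, max D₀ 3, fun D _ χ hD hq hp hA j hj n₁ hn hT => ?_⟩
  have hD3 : 3 ≤ D := le_trans (le_max_right _ _) hD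
  refine (hD₀ D χ (le_trans (le_max_left _ _) hD) hq hp hA j hj n₁ hn hT).trans ?_
  have hτ : (0 : ℝ) ≤ n₁.divisors.card := Nat.cast_nonneg _
  have hαℓ : 0 ≤ alpha D * ell D := mul_nonneg (alpha_pos hD3).le (by linarith [one_lt_ell hD3])
  calc C * alpha D * ell D * n₁.divisors.card = C * (alpha D * ell D) * n₁.divisors.card := by ring
    _ ≤ |C| * (alpha D * ell D) * n₁.divisors.card := by gcongr; exact le_abs_self C
    _ ≤ |C| * alpha1 D * n₁.divisors.card := by gcongr; exact alpha_mul_ell_le_alpha1 hD3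

/-- `Ded1217R` (from the weaker `Lemma121R`) implies the banked `Ded1217`.
[cite: Zhang2022LandauSiegel, §12 (12.6)–(12.17)] -/
theorem ded1217_of_ded1217R {c' : ℝ} (h : Ded1217R c') : Ded1217 c' :=
  fun h71 h81 h82 h83 h84 h58 h121 h123 => h h71 h81 h82 h83 h84 h58 (lemma121R_of_lemma121 h121) h123

/-- `Ded1524ChiR` implies `Ded1524Chi`. [cite: Zhang2022LandauSiegel, §15 (15.1)–(15.24)] -/
theorem ded1524Chi_of_R {c' : ℝ} (h : Ded1524ChiR c') : Ded1524Chi c' :=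
  fun h141 h55 h58 h151 => h h141 h55 h58 (lemma151ChiR_of_lemma151Chi h151)

/-- `Ded1617ChiR` implies `Ded1617Chi`. [cite: Zhang2022LandauSiegel, §16 (16.1)–(16.17)] -/
theorem ded1617Chi_of_R {c' : ℝ} (h : Ded1617ChiR c') : Ded1617Chi c' :=
  fun h141 h55 h58 h151 => h h141 h55 h58 (lemma151ChiR_of_lemma151Chi h151)

/-- `Ded1710ChiR` implies `Ded1710Chi`. [cite: Zhang2022LandauSiegel, §17 (17.1)–(17.10)] -/
theorem ded1710Chi_of_R {c' : ℝ} (h : Ded1710ChiR c') : Ded1710Chi c' :=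
  fun h141 h171 h151 => h h141 h171 (lemma151ChiR_of_lemma151Chi h151)

end Literature.NumberTheory.LFunctions.Zhang2022.Skeleton
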